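/-
Copyright (c) 2026 the pub-hodgecm-mathlib formalisation cell (harness21).  Prover seat hodgecm-mathlib-F0P3a-p03 (g21), 2026-09-02 (LH7 leaf ED. 3 road, (O8b♭) local,
«DET-SCALAR» road: the local scalar `det g · 1` and the transport of central elements `U(J)(F_v) → U(J)(𝔸_{F,f}) → U(J)(𝔸_F)`).
-/
import Literature.NumberTheory.Automorphic.UnitaryGroupPlaceInclusion        -- ★ `inclPlace`, `inclPlaceAdelic`, `exists_eq_mul_inclPlace`, `commute_inclPlace_of_evalPlace_eq_one`, `commute_archToAdelic_inclPlaceAdelic`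
import Literature.NumberTheory.Automorphic.UnitaryGroupFinAdelicCenterLocal  -- ★ `map_smul_one`
import HarnessLib

/-!
# The local determinant scalar `(det g_w · 1_N)_w ∈ U(J)(F_v)` and central elements of `U(J)(F_v)` inside `U(J)(𝔸_F)`

Registry: pub-hodgecm MODEL-CONSTRUCTION sub-cell, companion of ★ `UnitaryGroupPlaceInclusion` (`inclPlace v`, `inclPlaceAdelic v`) and ★
`UnitaryGroupFinAdelicCenterLocal` (`localCenter`).  THEOREMS ONLY: no definition, no named fact, no instance, no notation, no `sorry`.

For a number-field extension `E ∕ F`, `c ∈ Aut(E ∕ F)`, `J ∈ M_N(E)` with `det J ≠ 0` and a finite place `v` of `F`, let `g = (g_w)_{w ∣ v} ∈ U(J)(F_v)` (factor form ★ `localPi E c N J v ≤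
Π_{w ∣ v} GL_N(E_w)`).  THE MATHEMATICS:
* §1 `galMap_det_mul_det_eq_one` — taking determinants in the membership relation ★ `mem_localPi_iff` (`ᵗ(c_* g_{c⁻¹w}) · J_w · g_w = J_w`) gives the NORM-ONE RELATION of the
  determinant, `c_*(det g_{c⁻¹ w}) · det g_w = 1` (`det J_w = det J ≠ 0`);
* §2 the **determinant scalar** `z_g := (det g_w · 1_N)_w ∈ Π_w GL_N(E_w)` lies in `U(J)(F_v)` (`scalar_det_mem_localPi`: `ᵗ(c_*(d′·1)) J_w (d·1) = (c_*(d′) d) J_w = J_w` by §1),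
  commutes with EVERY element of `Π_w GL_N(E_w)` (`mul_scalar_det_comm`), and has `det (z_g)_w = (det g_w)^N` (`det_scalar_det_apply`); for `N = 2` the element `g · g · z_g⁻¹` has all
  its components of determinant `1` (`det_apply_mul_mul_scalar_det_inv_eq_one`), as does every commutator `k⁻¹ g⁻¹ k g` (`det_apply_commutator_eq_one`, any `N`);
* §3 an element `z ∈ U(J)(F_v)` commuting with `U(J)(F_v)` is CENTRAL in `U(J)(𝔸_{F,f})` after ★ `inclPlace v` (`inclPlace_mem_center_of_forall_mul_comm`: factor `h = h′ · ι_v(h_v)`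
  with `h′_v = 1`, ★ `exists_eq_mul_inclPlace` ∕ ★ `commute_inclPlace_of_evalPlace_eq_one`) and in `U(J)(𝔸_F)` after ★ `inclPlaceAdelic v` (`inclPlaceAdelic_mem_center_of_forall_mul_comm`:
  `a = a_∞ · a_f`, ★ `archToAdelic_mul_finAdelicToAdelic` ∕ ★ `commute_archToAdelic_inclPlaceAdelic`); in particular `ι_v(z_g)` is central in `U(J)(𝔸_F)`
  (`inclPlaceAdelic_scalar_det_mem_center`), so it acts by a scalar on every topologically irreducible unitary representation of `U(J)(𝔸_F)` (Schur).
CONSUMER (cell `hodgecm-mathlib`, crux H413, line LH7, (O8b♭) local isotypy): with ★ `IrrClass.apply_eq_smul_of_forall_isConstituentOf_eq_mk_ofChar_of_forall_exists_sq_mul_inv_mem_closure`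
(★ `SmoothRepUniqueConstituentDetScalar`) the hypotheses «`z` acts by a scalar», «`t t z⁻¹ ∈ G°`», «`[G,G] ⊆ G°`» at `G = U(Φ₂)(L⁺_v)` reduce to «every `u ∈ U(Φ₂)(L⁺_v)` with all
`det u_w = 1` lies in `G°`» — `Summits/…/Theorems/F0P3cPKtupleU2LocalIsotypy`.
HONEST LABEL: model plumbing ([PlatonovRapinchuk1994] §5.1; [Mok2014] §1); HC_CM is proved only modulo the printed citations of that programme until its rung 0 closes; this file
proves no printed citation of it.

## References
* [PlatonovRapinchuk1994] V. Platonov, A. Rapinchuk, *Algebraic Groups and Number Theory* (1994), §5.1 (adelic points as restricted products; local factors), §2.3.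
* [Mok2014] C. P. Mok, *Endoscopic classification of representations of quasi-split unitary groups*, Mem. AMS 235 (2015), §1 Notation p. 5 (the centre `U_{E∕F}(1)` of `U_{E∕F}(N)`).
* [BorelJacquet1979] A. Borel, H. Jacquet, *Automorphic forms and automorphic representations*, Corvallis (1979), §4.1.
* [BourbakiAlgebraI1989] N. Bourbaki, *Algebra I, Chapters 1–3* (1989), Ch. III §8 (determinants).
-/

set_option autoImplicit false

noncomputable section

open scoped Matrix
open NumberField IsDedekindDomain

namespace Literature.NumberTheory.Automorphic.UnitaryGroup

variable (F E : Type) [Field F] [NumberField F] [Field E] [NumberField E] [Algebra F E]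
variable (c : E ≃ₐ[F] E) (N : ℕ) (J : Matrix (Fin N) (Fin N) E)

variable {F}

/-! ## §1 The norm-one relation of the determinant -/

/-- **`c_*(det g_{c⁻¹w}) · det g_w = 1`** for `g ∈ U(J)(F_v)` and `w ∣ v` (`det J ≠ 0`): the determinant of the membership relation `ᵗ(c_* g_{c⁻¹w}) · J_w · g_w = J_w`
(★ `mem_localPi_iff`), `det J_w = det J ≠ 0` cancelled. [cite: PlatonovRapinchuk1994, §5.1] [cite: Mok2014, §1 Notation p. 5] -/
theorem galMap_det_mul_det_eq_one (hJ : J.det ≠ 0) (v : HeightOneSpectrum (𝓞 F)) (g : localPi E c N J v) (w : PlacesOver E v) :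
    galAdicCompletionMap c (smul_inv_smul c w.1)
        (((g : LocalGLPi E N v) (PlacesOver.galInv c w) : GL (Fin N) ((PlacesOver.galInv c w).1.adicCompletion E)) :
          Matrix (Fin N) (Fin N) ((PlacesOver.galInv c w).1.adicCompletion E)).det *
      (((g : LocalGLPi E N v) w : GL (Fin N) (w.1.adicCompletion E)) : Matrix (Fin N) (Fin N) (w.1.adicCompletion E)).det = 1 := by
  have hg := congrArg Matrix.det ((mem_localPi_iff E c N J v (g : LocalGLPi E N v)).1 g.2 w)
  rw [Matrix.det_mul, Matrix.det_mul, Matrix.det_transpose, ← RingHom.mapMatrix_apply, ← RingHom.map_det] at hg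
  have hdet : (placeForm J w.1).det ≠ 0 := by
    have e : (placeForm J w.1).det = algebraMap E (w.1.adicCompletion E) J.det := (RingHom.map_det (algebraMap E (w.1.adicCompletion E)) J).symm
    rw [e]
    exact (map_ne_zero _).2 hJ
  refine mul_right_cancel₀ hdet ?_
  rw [one_mul, mul_right_comm]
  exact hg

/-! ## §2 The determinant scalar `z_g = (det g_w · 1_N)_w` -/

omit [NumberField F] in
/-- matrix of the `w`-component of the determinant scalar: `det g_w · 1_N`. [cite: Mok2014, §1 Notation p. 5] -/
theorem coe_scalar_det_apply (v : HeightOneSpectrum (𝓞 F)) (g : LocalGLPi E N v) (w : PlacesOver E v) :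
    ((Units.map (Matrix.scalar (Fin N) : w.1.adicCompletion E →+* Matrix (Fin N) (Fin N) (w.1.adicCompletion E)).toMonoidHom
        (Matrix.GeneralLinearGroup.det (g w)) : GL (Fin N) (w.1.adicCompletion E)) : Matrix (Fin N) (Fin N) (w.1.adicCompletion E)) =
      ((g w : GL (Fin N) (w.1.adicCompletion E)) : Matrix (Fin N) (Fin N) (w.1.adicCompletion E)).det • (1 : Matrix (Fin N) (Fin N) (w.1.adicCompletion E)) := by
  change Matrix.scalar (Fin N) ((Matrix.GeneralLinearGroup.det (g w) : (w.1.adicCompletion E)ˣ) : w.1.adicCompletion E) = _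
  rw [Matrix.GeneralLinearGroup.val_det_apply, Matrix.scalar_apply, Matrix.smul_one_eq_diagonal]

/-- **The determinant scalar lies in `U(J)(F_v)`**: `(det g_w · 1_N)_{w ∣ v} ∈ localPi v` for `g ∈ localPi v` (`det J ≠ 0`) — `ᵗ(c_*(d′ · 1)) · J_w · (d · 1) = (c_*(d′) d) · J_w = J_w` by §1.
[cite: Mok2014, §1 Notation p. 5] [cite: PlatonovRapinchuk1994, §5.1] -/
theorem scalar_det_mem_localPi (hJ : J.det ≠ 0) (v : HeightOneSpectrum (𝓞 F)) (g : localPi E c N J v) :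
    (fun w : PlacesOver E v =>
        Units.map (Matrix.scalar (Fin N) : w.1.adicCompletion E →+* Matrix (Fin N) (Fin N) (w.1.adicCompletion E)).toMonoidHom
          (Matrix.GeneralLinearGroup.det ((g : LocalGLPi E N v) w))) ∈ localPi E c N J v := by
  rw [mem_localPi_iff]
  intro w
  rw [coe_scalar_det_apply, coe_scalar_det_apply, map_smul_one, Matrix.transpose_smul, Matrix.transpose_one, Matrix.smul_mul, Matrix.one_mul,
    Matrix.mul_smul, Matrix.mul_one, smul_smul, mul_comm, galMap_det_mul_det_eq_one E c N J hJ v g w, one_smul]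

omit [NumberField F] in
/-- **The determinant scalar is central in `Π_{w ∣ v} GL_N(E_w)`** (scalar matrices commute with everything). [cite: Mok2014, §1 Notation p. 5] -/
theorem mul_scalar_det_comm (v : HeightOneSpectrum (𝓞 F)) (g k : LocalGLPi E N v) :
    k * (fun w : PlacesOver E v =>
        Units.map (Matrix.scalar (Fin N) : w.1.adicCompletion E →+* Matrix (Fin N) (Fin N) (w.1.adicCompletion E)).toMonoidHom
          (Matrix.GeneralLinearGroup.det (g w))) =
      (fun w : PlacesOver E v =>
        Units.map (Matrix.scalar (Fin N) : w.1.adicCompletion E →+* Matrix (Fin N) (Fin N) (w.1.adicCompletion E)).toMonoidHom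
          (Matrix.GeneralLinearGroup.det (g w))) * k := by
  refine funext fun w => Units.ext ?_
  rw [Pi.mul_apply, Pi.mul_apply, Units.val_mul, Units.val_mul, coe_scalar_det_apply, Matrix.mul_smul, Matrix.mul_one, Matrix.smul_mul, Matrix.one_mul]

omit [NumberField F] in
/-- **`det (z_g)_w = (det g_w)^N`**. [cite: Mok2014, §1 Notation p. 5] -/
theorem det_scalar_det_apply (v : HeightOneSpectrum (𝓞 F)) (g : LocalGLPi E N v) (w : PlacesOver E v) :
    ((Units.map (Matrix.scalar (Fin N) : w.1.adicCompletion E →+* Matrix (Fin N) (Fin N) (w.1.adicCompletion E)).toMonoidHom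
        (Matrix.GeneralLinearGroup.det (g w)) : GL (Fin N) (w.1.adicCompletion E)) : Matrix (Fin N) (Fin N) (w.1.adicCompletion E)).det =
      ((g w : GL (Fin N) (w.1.adicCompletion E)) : Matrix (Fin N) (Fin N) (w.1.adicCompletion E)).det ^ N := by
  rw [coe_scalar_det_apply, Matrix.det_smul, Matrix.det_one, mul_one, Fintype.card_fin]

omit [NumberField F] in
/-- **`N = 2`: every component of `g · g · z_g⁻¹` has determinant `1`** (`det² ∕ det² = 1`). [cite: Mok2014, §1 Notation p. 5] -/
theorem det_apply_mul_mul_scalar_det_inv_eq_one (v : HeightOneSpectrum (𝓞 F)) (g : LocalGLPi E 2 v) (w : PlacesOver E v) :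
    (((g * g * (fun w : PlacesOver E v =>
        Units.map (Matrix.scalar (Fin 2) : w.1.adicCompletion E →+* Matrix (Fin 2) (Fin 2) (w.1.adicCompletion E)).toMonoidHom
          (Matrix.GeneralLinearGroup.det (g w)))⁻¹) w : GL (Fin 2) (w.1.adicCompletion E)) : Matrix (Fin 2) (Fin 2) (w.1.adicCompletion E)).det = 1 := by
  have hz : Matrix.GeneralLinearGroup.det
      (Units.map (Matrix.scalar (Fin 2) : w.1.adicCompletion E →+* Matrix (Fin 2) (Fin 2) (w.1.adicCompletion E)).toMonoidHom
        (Matrix.GeneralLinearGroup.det (g w))) =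
      Matrix.GeneralLinearGroup.det (g w) * Matrix.GeneralLinearGroup.det (g w) :=
    Units.ext (by rw [Matrix.GeneralLinearGroup.val_det_apply, det_scalar_det_apply, Units.val_mul, Matrix.GeneralLinearGroup.val_det_apply, pow_two])
  rw [← Matrix.GeneralLinearGroup.val_det_apply, Pi.mul_apply, Pi.mul_apply, Pi.inv_apply, map_mul, map_mul, map_inv, hz, mul_inv_cancel,
    Units.val_one]

omit [NumberField F] in
/-- **Every component of a commutator `k⁻¹ g⁻¹ k g` has determinant `1`** (any `N`; `det` is a homomorphism to the commutative group `E_wˣ`).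
[cite: BourbakiAlgebraI1989, Ch. III §8 no. 3 (multiplicativity of the determinant)] [cite: PlatonovRapinchuk1994, §5.1] -/
theorem det_apply_commutator_eq_one (v : HeightOneSpectrum (𝓞 F)) (g k : LocalGLPi E N v) (w : PlacesOver E v) :
    (((k⁻¹ * g⁻¹ * k * g) w : GL (Fin N) (w.1.adicCompletion E)) : Matrix (Fin N) (Fin N) (w.1.adicCompletion E)).det = 1 := by
  rw [← Matrix.GeneralLinearGroup.val_det_apply, Pi.mul_apply, Pi.mul_apply, Pi.mul_apply, Pi.inv_apply, Pi.inv_apply, map_mul, map_mul, map_mul,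
    map_inv, map_inv, show (Matrix.GeneralLinearGroup.det (k w))⁻¹ * (Matrix.GeneralLinearGroup.det (g w))⁻¹ * Matrix.GeneralLinearGroup.det (k w) *
        Matrix.GeneralLinearGroup.det (g w) = 1 by
      rw [mul_comm (Matrix.GeneralLinearGroup.det (k w))⁻¹, mul_assoc, mul_assoc, inv_mul_cancel_left, inv_mul_cancel], Units.val_one]

/-! ## §3 Central elements of `U(J)(F_v)` are central in `U(J)(𝔸_{F,f})` and in `U(J)(𝔸_F)` -/

variable (F)

/-- **An element of `U(J)(F_v)` commuting with `U(J)(F_v)` is central in `U(J)(𝔸_{F,f})`** after ★ `inclPlace v`: every `h ∈ U(J)(𝔸_{F,f})` factors as `h′ · ι_v(h_v)` with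
`h′_v = 1` (★ `exists_eq_mul_inclPlace`), `h′` commutes with `ι_v(U(J)(F_v))` (★ `commute_inclPlace_of_evalPlace_eq_one`) and `ι_v` is a homomorphism.
[cite: PlatonovRapinchuk1994, §5.1] -/
theorem inclPlace_mem_center_of_forall_mul_comm (v : HeightOneSpectrum (𝓞 F)) (z : localPi E c N J v) (hz : ∀ k : localPi E c N J v, k * z = z * k) :
    inclPlace F E c N J v z ∈ Subgroup.center (finAdelic F E c N J) := by
  rw [Subgroup.mem_center_iff]
  intro h
  obtain ⟨h', hh'1, -, hh⟩ := exists_eq_mul_inclPlace F E c N J v h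
  rw [hh, mul_assoc, ← map_mul, hz, map_mul, ← mul_assoc, ← mul_assoc, (commute_inclPlace_of_evalPlace_eq_one F E c N J hh'1 z).eq]

/-- **An element of `U(J)(F_v)` commuting with `U(J)(F_v)` is central in `U(J)(𝔸_F)`** after ★ `inclPlaceAdelic v`: `a = a_∞ · a_f` (★ `archToAdelic_mul_finAdelicToAdelic`), the
archimedean factor commutes with `ι_v` (★ `commute_archToAdelic_inclPlaceAdelic`) and the finite factor by `inclPlace_mem_center_of_forall_mul_comm`.
[cite: BorelJacquet1979, §4.1] [cite: PlatonovRapinchuk1994, §5.1] -/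
theorem inclPlaceAdelic_mem_center_of_forall_mul_comm (v : HeightOneSpectrum (𝓞 F)) (z : localPi E c N J v) (hz : ∀ k : localPi E c N J v, k * z = z * k) :
    inclPlaceAdelic F E c N J v z ∈ Subgroup.center (adelicGroupData F E c N J).Adelic := by
  rw [Subgroup.mem_center_iff]
  intro a
  have hfin : finAdelicToAdelic F E c N J (finPart F E c N J a) * inclPlaceAdelic F E c N J v z =
      inclPlaceAdelic F E c N J v z * finAdelicToAdelic F E c N J (finPart F E c N J a) := by
    rw [inclPlaceAdelic_apply, ← map_mul, ← map_mul, Subgroup.mem_center_iff.1 (inclPlace_mem_center_of_forall_mul_comm F E c N J v z hz) _]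
  calc a * inclPlaceAdelic F E c N J v z
      = archToAdelic F E c N J (archPart F E c N J a) * (finAdelicToAdelic F E c N J (finPart F E c N J a) * inclPlaceAdelic F E c N J v z) := by
        rw [← mul_assoc, archToAdelic_mul_finAdelicToAdelic]
    _ = inclPlaceAdelic F E c N J v z * (archToAdelic F E c N J (archPart F E c N J a) * finAdelicToAdelic F E c N J (finPart F E c N J a)) := by
        rw [hfin, ← mul_assoc, (commute_archToAdelic_inclPlaceAdelic F E c N J (archPart F E c N J a) v z).eq, mul_assoc]
    _ = inclPlaceAdelic F E c N J v z * a := by rw [archToAdelic_mul_finAdelicToAdelic]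

variable {F}

/-- **`ι_v(z_g)` is central in `U(J)(𝔸_F)`** for the determinant scalar `z_g = (det g_w · 1_N)_w` of `g ∈ U(J)(F_v)` (`det J ≠ 0`): §2 + `inclPlaceAdelic_mem_center_of_forall_mul_comm`.
Hence it acts by a scalar on every topologically irreducible unitary representation of `U(J)(𝔸_F)` (Schur), e.g. on a discrete automorphic `P`.
[cite: Mok2014, §1 Notation p. 5] [cite: BorelJacquet1979, §4.1] -/
theorem inclPlaceAdelic_scalar_det_mem_center (hJ : J.det ≠ 0) (v : HeightOneSpectrum (𝓞 F)) (g : localPi E c N J v) :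
    inclPlaceAdelic F E c N J v ⟨fun w : PlacesOver E v =>
        Units.map (Matrix.scalar (Fin N) : w.1.adicCompletion E →+* Matrix (Fin N) (Fin N) (w.1.adicCompletion E)).toMonoidHom
          (Matrix.GeneralLinearGroup.det ((g : LocalGLPi E N v) w)), scalar_det_mem_localPi E c N J hJ v g⟩ ∈
      Subgroup.center (adelicGroupData F E c N J).Adelic :=
  inclPlaceAdelic_mem_center_of_forall_mul_comm F E c N J v _ fun k => Subtype.ext (mul_scalar_det_comm E N v (g : LocalGLPi E N v) (k : LocalGLPi E N v))

end Literature.NumberTheory.Automorphic.UnitaryGroup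

end
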